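import Literature.Computability.Complexity.StackBricks
import Literature.Computability.Complexity.StackUnary
import HarnessLib

/-!
# Unary bricks: halving and binary logarithm of a length as `FP` functions

Trunk toolkit continuing `StackBricks.lean` (`Brick.unOp_mem_FP`: a verified stack routine on one
operand is a total `FP` string function) with the unary routines `Com.halve` / `Com.logCount` of
`StackUnary.lean`. A word `w` is read as the unary number `|w|` (its symbols are irrelevant: each
brick first recodes its operand as `1^{|w|}`, `Com.runs_onesify`), and the bricks return

* `Brick.halfFn w = 1^{⌊|w|/2⌋}` (`halfFn_mem_FP`) — new;
* `Brick.logFn w = 1^{⌊log₂ |w|⌋}` (`logFn_mem_FP`; `Nat.log 2`, so `|w| ≤ 1 ↦ []`) — the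
  Complexity-topic home of this brick: it is a **twin** of `Cryptography.CondRed.logU`
  (`Cryptography/LiuPassCondRedProgram.lean`, `logU_apply`, `logU_mem_FP`), which the librarian
  should retire in favour of this one.

Existing bricks of the same family that consumers should use directly (NOT re-declared here):
`Plumb.polyFn Q w = 1^{Q(|w|)}` (`PlumbingBricks.lean`), `HashBricks.umulFn ⟨a, b⟩ = 1^{|a| |b|}`
(`HashBricks.lean`), `Brick.lenBinF w = encodeNat |w|` (`FoldBricks.lean`),
`Plumb.divModFn ⟨1ᴷ, 1ᵃ⟩ = ⟨1^{a / K}, 1^{a mod K}⟩`, `Plumb.takeFn` / `Plumb.dropFn`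
(`PlumbingBricks.lean`), `FPStringBricks.binToUnaryFn`.

First consumer: the `2^{O(n / log n)}`-time machine of Hirahara's Cor. 6.4
(`MetaComplexity/UniversalHeuristicSchemes.lean`), whose parameters are `⌊log₂ n⌋`-based.

## References

* S. Arora, B. Barak, *Computational Complexity: A Modern Approach*, CUP 2009, §1.3 (polynomial
  time is robust; counters and arithmetic on work tapes), §3.1 (time-constructible functions).
* T. Nipkow, G. Klein, *Concrete Semantics with Isabelle/HOL*, Springer 2014, Ch. 7 (big-step
  verification of loops).
-/

namespace Literature.Computability.Complexity

open _root_.Computability Polynomial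

namespace Com

variable {ι : Type} [DecidableEq ι]

/-- **Recoding a register in unary**: `loop k (push t true) (push t true)` empties `k` and puts
`1^{|R k|}` on top of `t` (cost `3 |R k| + 1`). Complexity-topic home of this routine lemma: it is
a **twin** (same program, registers and cost) of `Com.runs_onesOf`
(`Algebra/EuclideanLattices/GapCVPPrimeMachine.lean`) and of `LiuPassHeurBricks.cntRest`'s loop
(`Cryptography/`); the librarian should retire those copies in favour of this one. [folklore] -/
theorem runs_onesify {k t : ι} (hkt : k ≠ t) : ∀ (w : List Bool) (R : Regs ι), R k = w →
    Runs (loop k (push t true) (push t true)) R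
      (Function.update (Function.update R k []) t (ones w.length ++ R t)) (3 * w.length + 1)
  | [], R, hk => by
    refine (Runs.loop_nil _ _ hk).of_eq ?_ (by simp)
    ext i : 1
    simp only [Function.update_apply]
    split_ifs <;> simp_all [ones]
  | b :: w, R, hk => by
    have hbody : Runs (push t true) (Function.update R k w)
        (Function.update (Function.update R k w) t (true :: R t)) 1 :=
      (Runs.push t true _).of_eq (by rw [Function.update_of_ne hkt.symm]) le_rfl
    have ih := runs_onesify hkt w (Function.update (Function.update R k w) t (true :: R t))
      (by rw [Function.update_of_ne hkt, Function.update_self])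
    have e : Function.update (Function.update (Function.update (Function.update R k w) t (true :: R t)) k [])
        t (ones w.length ++ (Function.update (Function.update R k w) t (true :: R t)) t) =
        Function.update (Function.update R k []) t (ones (b :: w).length ++ R t) := by
      ext i : 1
      simp only [Function.update_apply]
      split_ifs <;> simp_all [ones, List.replicate_succ']
    have hcost : 1 + 2 + (3 * w.length + 1) ≤ 3 * (b :: w).length + 1 := by simp; omega
    cases b
    · exact (Runs.loop_false hk hbody ih).of_eq e hcost
    · exact (Runs.loop_true hk hbody ih).of_eq e hcost

end Com

namespace Brick

/-- Registers of the unary bricks: the operand `inp`, the fuel `f` and the value `v` of the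
logarithm loop, its scratch `a`, and the result `d`. [folklore] -/
inductive UB
  | inp | f | v | a | d
  deriving DecidableEq, Fintype, Repr

/-! ### Halving -/

/-- `halfFn w = 1^{⌊|w|/2⌋}`. [folklore] -/
def halfFn (w : List Bool) : List Bool := ones (w.length / 2)

/-- `|halfFn w| = ⌊|w|/2⌋`. [folklore] -/
@[simp] theorem length_halfFn (w : List Bool) : (halfFn w).length = w.length / 2 := by
  simp [halfFn, ones]

/-- The halving brick's routine: recode the operand in unary on `v`, then `Com.halve v d`.
[folklore] -/
def halfPrg : Com UB := Com.loop UB.inp (Com.push UB.v true) (Com.push UB.v true) ;; Com.halve UB.v UB.d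

/-- **`halfFn ∈ FP`** (cost `8 n + 2`). [Arora–Barak 2009, §1.3] [folklore] -/
theorem halfFn_mem_FP : halfFn ∈ FP := by
  refine unOp_mem_FP halfPrg UB.inp UB.d halfFn (fun n => 8 * n + 2) (8 * X + 2)
    (fun n => by simp) (fun a => ?_) (fun a => ?_)
  · simp only [length_halfFn, eval_add, eval_mul, eval_ofNat, eval_X]; omega
  · have h1 := Com.runs_onesify (k := UB.inp) (t := UB.v) (by decide) a (init1 UB.inp a)
      (by simp [init1])
    set R₁ := Function.update (Function.update (init1 UB.inp a) UB.inp []) UB.v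
      (ones a.length ++ (init1 UB.inp a) UB.v) with hR₁
    have hv : R₁ UB.v = ones a.length := by simp [hR₁, init1]
    have h2 := Com.runs_halve (v := UB.v) (a := UB.d) (by decide) a.length R₁ hv
    refine ⟨_, (h1.seq h2).mono (by omega), ?_⟩
    simp [hR₁, init1, halfFn]

/-! ### Binary logarithm -/

/-- `logFn w = 1^{⌊log₂ |w|⌋}` (`Nat.log 2`, so `|w| ≤ 1 ↦ []`). Twin of
`Cryptography.CondRed.logU` (to be retired in favour of this Complexity-topic copy). [folklore] -/
def logFn (w : List Bool) : List Bool := ones (Nat.log 2 w.length)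

/-- `|logFn w| = ⌊log₂ |w|⌋`. [folklore] -/
@[simp] theorem length_logFn (w : List Bool) : (logFn w).length = Nat.log 2 w.length := by
  simp [logFn, ones]

/-- The logarithm brick's routine: recode the operand in unary on the fuel `f` and the value `v`
(the loop of `Com.addReg`), then `Com.logCount f v a d` (repeated halving, `StackUnary.lean`).
[folklore] -/
def logPrg : Com UB :=
  Com.loop UB.inp (Com.push UB.f true ;; Com.push UB.v true) (Com.push UB.f true ;; Com.push UB.v true) ;;
    Com.logCount UB.f UB.v UB.a UB.d

/-- **`logFn ∈ FP`** (cost `7 n² + 17 n + 2`). [Arora–Barak 2009, §1.3] [folklore] -/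
theorem logFn_mem_FP : logFn ∈ FP := by
  refine unOp_mem_FP logPrg UB.inp UB.d logFn (fun n => 4 * n + 1 + (n * (7 * n + 13) + 1))
    (7 * X ^ 2 + 17 * X + 2) (fun n => ?_) (fun a => ?_) (fun a => ?_)
  · simp only [eval_add, eval_mul, eval_ofNat, eval_pow, eval_X]; nlinarith
  · simp only [length_logFn, eval_add, eval_mul, eval_ofNat, eval_pow, eval_X]
    have := Nat.log_le_self 2 a.length
    nlinarith
  · have h1 := Com.runs_addReg_loop (p := UB.inp) (v := UB.f) (t := UB.v) (by decide) (by decide)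
      (by decide) a (init1 UB.inp a) (by simp [init1])
    set R₁ := Function.update (Function.update (Function.update (init1 UB.inp a) UB.inp []) UB.f
      (ones a.length ++ (init1 UB.inp a) UB.f)) UB.v (ones a.length ++ (init1 UB.inp a) UB.v) with hR₁
    have h2 := Com.runs_logCount (f := UB.f) (v := UB.v) (a := UB.a) (d := UB.d) (by decide)
      (by decide) (by decide) (by decide) (by decide) (by decide) a.length a.length 0 R₁
      (by simp [hR₁, init1]) (by simp [hR₁, init1]) (by simp [hR₁, init1]) (by simp [hR₁, init1, ones])
    refine ⟨_, (h1.seq h2).mono le_rfl, ?_⟩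
    simp [hR₁, init1, logFn, Com.logC_snd a.length a.length 0 le_rfl]


end Brick

end Literature.Computability.Complexity
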